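import Summits.QuantumFields.BalabanUV.T4Continuum.Support.NE7SliceLetterConstantFluxWitness
import Summits.QuantumFields.BalabanUV.T4Continuum.Support.NE3HessBounds
import HarnessLib

/-!
# NE7SliceLetterHomTwoTermWitness — THE REPAIRED SLICE-SOLVER LETTER (L2)ʰ IS SATISFIABLE AT EVERY BACKGROUND: with `K_G = 0`, `K_X = 4` the homogeneous two-term letter
# `‖curlAt W X z μ ν‖ ≤ K_G·g + K_X·R` holds for EVERY unitary `W`, EVERY set `S` and EVERY field with `‖X‖_∞ ≤ R` (`‖(d_W X)(p)‖ ≤ Σ_{b⊂∂p}‖X(b)‖`); in particular at the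
# constant-flux backgrounds where the one-term letter of F112 … F123d FAILS (F130), the hypothesis `hG` of the twins `…H` (this generation's re-thread) HOLDS — the re-threaded END
# `NE7ApeCurvedRepRoadBGradientClassH` is NOT vacuous through its slice-solver letter; its content is the SIZE of `(K_G, K_X)` the assembler can afford (file 66 of the curved (APE))

Cell `pub-balaban`, rung (B)+1 sub-cell t4, lineage `b2b-balaban-t4-ne7-p1` (CRUX PROVER NE7 #1 = OWNER of row NE7), generation 80; memo
`t4/b2b-balaban-t4-ne7-p1-g80/SLICE-LETTER-OBSTRUCTION.md` §3 PS ∕ §5.  File F136, over row NE3's `NE3HessBounds.norm_curlAt_le` and F130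
`NE7SliceLetterConstantFluxWitness.exists_admissible_background_not_sliceLetter`.
WHAT ([folklore]; 0 def, 0 sorry).  §1 **`homTwoTerm_trivial`** — (L2)ʰ with `(K_G, K_X) = (0, 4)` at every unitary `W`, for every `S`, period, level; §2 **`homTwoTerm_holds_where_oneTerm_fails`**
— for every `d ≥ 2`, `card n ≥ 2`, `L ≥ 2`, `j` there are `N`, `x`, `W` with all of F123d's background hypotheses at which the ONE-TERM letter fails for every `S ⊇ tangent` and every
`K_G` (F130) WHILE (L2)ʰ holds for every `S` with `(K_G, K_X) = (0, 4)`.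
HONEST FRAMING (page 1): the trivial constants `(0, 4)` certify CONSISTENCY only — with `K_X = 4` the re-threaded END's radius carries `4(α₀ + a_N)`, useless for the bootstrap; the
analytic question (memo §3 (iv)) is whether `K_X ≲ E_W∕M` with `K_G ≲ K·M` holds on the slice — Bałaban's background-field propagator, NOT in the tree.  Nothing of Bałaban's
asserted; NOT ONE-STEP, NOT NE7; spine 0∕9; finite T⁴ rung (B)+1 — NOT infinite volume, NOT mass gap, NOT `BetaPertH`, NOT Clay.  Continuum YM on T⁴ ⇐ BetaPertH ∧ nine spine
estimates (0/9 proved); BetaPertH ⇐ (D1) ∧ (D4) ∧ CAP+tail; G-an2-4 gates asym, D1 and NE2/3/4.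
-/

set_option autoImplicit false

open scoped BigOperators Matrix.Norms.L2Operator
open NormedSpace Finset

namespace Summit.QuantumFields.BalabanUV.T4Continuum.NE7SliceLetterHomTwoTermWitness

open Literature.MathematicalPhysics.QuantumFieldTheory.Balaban1983to89
open B7Prop1Explicit B7Prop2Explicit UnitaryModel
open T4AveragingDeficitWall (Ad IsUnitaryCfg IsSkewDir SmallField curlAt dirL1 covGrad flux)
open T4AveragingDeficitWallBoundary (IsPeriodicCfg periodBox)
open AveragingDeficitPeriodicCounting (IsPeriodicDir)
open AveragingDeficitMultiLevelPrep (LevelSmall)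
open MinimalActionLevels (perWin)
open NE3HessForm (hess dAction)
open NE3TangentCovariantTower (dirIter)
open NE3HessBounds (norm_curlAt_le)
open NE7SliceLetterConstantFluxWitness (exists_admissible_background_not_sliceLetter)

noncomputable section

variable {d : ℕ} {n : Type*} [Fintype n] [DecidableEq n]

/-! ## §1 (L2)ʰ with the trivial constants -/

/-- **(L2)ʰ HOLDS AT EVERY UNITARY BACKGROUND WITH `K_G = 0`, `K_X = 4`** (every `S`, `L`, `N`, `j`; neither tangency nor the functional hypothesis is used):
`‖(d_W X)(p)‖ ≤ Σ_{b⊂∂p}‖X(b)‖ ≤ 4R`. [folklore] -/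
theorem homTwoTerm_trivial {L N j : ℕ} {W : Site d → Fin d → (Matrix n n ℂ)ˣ} (hWu : IsUnitaryCfg W) (S : Set (Site d → Fin d → Matrix n n ℂ)) :
    ∀ X ∈ S, IsPeriodicDir X ((N * L ^ (j + 1) : ℕ) : ℤ) → dirIter L (j + 1) W X = 0 → ∀ R : ℝ, (∀ y κ', ‖X y κ'‖ ≤ R) → ∀ g : ℝ, 0 ≤ g →
      (∀ Y : Site d → Fin d → Matrix n n ℂ, IsSkewDir Y → IsPeriodicDir Y ((N * L ^ (j + 1) : ℕ) : ℤ) → dirIter L (j + 1) W Y = 0 →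
        |hess W X Y (perWin d (N * L ^ (j + 1)))| ≤ g * dirL1 Y (periodBox (d := d) (N * L ^ (j + 1)))) →
      ∀ z μ' ν', μ' ≠ ν' → ‖curlAt W X z μ' ν'‖ ≤ 0 * g + 4 * R := by
  intro X _ _ _ R hR g _ _ z μ' ν' _
  have h := norm_curlAt_le hWu X z μ' ν'
  have h1 := hR z μ'
  have h2 := hR (z + e μ') ν'
  have h3 := hR (z + e ν') μ'
  have h4 := hR z ν'
  linarith

/-! ## §2 Where the one-term letter fails, the homogeneous letter holds -/

/-- **WHERE THE ONE-TERM LETTER FAILS, (L2)ʰ HOLDS**: for every `d ≥ 2`, `card n ≥ 2`, `L ≥ 2` and every `j` there are `N ≥ 1`, `x ≥ 0` and a background `W` satisfying all of F123d's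
background hypotheses (unitary, periodic, `LevelSmall d L j x`, `LevelSmall d L (j+1) x`, `SmallField W x`, tangent-critical, plaquette gradient `0`, flux gradient `0`) such that
(i) for every `S ⊇ {W-tangent skew periodic}` and every `K_G` the ONE-TERM letter `hG` of F123d FAILS (F130), and (ii) for every `S` the homogeneous two-term letter of the twins `…H`
HOLDS with `(K_G, K_X) = (0, 4)`. [folklore] -/
theorem homTwoTerm_holds_where_oneTerm_fails [Nonempty n] (hd : 2 ≤ d) (hn : ∃ i₀ i₁ : n, i₀ ≠ i₁) {L : ℕ} (hL : 2 ≤ L) (j : ℕ) :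
    ∃ (N : ℕ) (_ : NeZero N) (x : ℝ) (W : Site d → Fin d → (Matrix n n ℂ)ˣ),
      IsUnitaryCfg W ∧ IsPeriodicCfg W ((N * L ^ (j + 1) : ℕ) : ℤ) ∧ 0 ≤ x ∧ LevelSmall d L j x ∧ LevelSmall d L (j + 1) x ∧ SmallField W x ∧
      (∀ Y : Site d → Fin d → Matrix n n ℂ, IsSkewDir Y → IsPeriodicDir Y ((N * L ^ (j + 1) : ℕ) : ℤ) → dirIter L (j + 1) W Y = 0 →
        dAction W Y (perWin d (N * L ^ (j + 1))) = 0) ∧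
      (∀ (p : Site d) (μ κ : Fin d), κ ≠ μ →
        ‖Ad (W p μ) ((hol W (p + e μ) (plaqWord κ μ) : (Matrix n n ℂ)ˣ) : Matrix n n ℂ) - ((hol W p (plaqWord κ μ) : (Matrix n n ℂ)ˣ) : Matrix n n ℂ)‖ ≤ 0) ∧
      (∀ (z : Site d) (μ : Fin d) (π : T4AveragingDeficitWall.Plane d), ‖covGrad W (flux W) z μ π‖ ≤ 0) ∧
      (∀ (S : Set (Site d → Fin d → Matrix n n ℂ)),
        (∀ X : Site d → Fin d → Matrix n n ℂ, IsSkewDir X → IsPeriodicDir X ((N * L ^ (j + 1) : ℕ) : ℤ) → dirIter L (j + 1) W X = 0 → X ∈ S) →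
        ∀ KG : ℝ,
          ¬ (∀ X ∈ S, IsPeriodicDir X ((N * L ^ (j + 1) : ℕ) : ℤ) → dirIter L (j + 1) W X = 0 → ∀ g : ℝ, 0 ≤ g →
            (∀ Y : Site d → Fin d → Matrix n n ℂ, IsSkewDir Y → IsPeriodicDir Y ((N * L ^ (j + 1) : ℕ) : ℤ) → dirIter L (j + 1) W Y = 0 →
              |hess W X Y (perWin d (N * L ^ (j + 1)))| ≤ g * dirL1 Y (periodBox (d := d) (N * L ^ (j + 1)))) →
            ∀ z μ' ν', μ' ≠ ν' → ‖curlAt W X z μ' ν'‖ ≤ KG * g)) ∧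
      (∀ (S : Set (Site d → Fin d → Matrix n n ℂ)),
        ∀ X ∈ S, IsPeriodicDir X ((N * L ^ (j + 1) : ℕ) : ℤ) → dirIter L (j + 1) W X = 0 → ∀ R : ℝ, (∀ y κ', ‖X y κ'‖ ≤ R) → ∀ g : ℝ, 0 ≤ g →
          (∀ Y : Site d → Fin d → Matrix n n ℂ, IsSkewDir Y → IsPeriodicDir Y ((N * L ^ (j + 1) : ℕ) : ℤ) → dirIter L (j + 1) W Y = 0 →
            |hess W X Y (perWin d (N * L ^ (j + 1)))| ≤ g * dirL1 Y (periodBox (d := d) (N * L ^ (j + 1)))) →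
          ∀ z μ' ν', μ' ≠ ν' → ‖curlAt W X z μ' ν'‖ ≤ 0 * g + 4 * R) := by
  obtain ⟨N, hN, x, W, hWu, hWP, hx, hs, hs1, hWx, hcrit, hpg, hfg, hno⟩ := exists_admissible_background_not_sliceLetter (n := n) hd hn hL j
  exact ⟨N, hN, x, W, hWu, hWP, hx, hs, hs1, hWx, hcrit, hpg, hfg, hno, fun S => homTwoTerm_trivial hWu S⟩

end

end Summit.QuantumFields.BalabanUV.T4Continuum.NE7SliceLetterHomTwoTermWitness
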